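import Literature.AnabelianGeometry.AbsoluteAnabelian.LocalResidueMapQmodZ
import Literature.AnabelianGeometry.AbsoluteAnabelian.GaloisCyclotomeTowerLevels
import Literature.NumberTheory.GaloisRepresentations.ContinuousCohomologyTowerLimit
import HarnessLib

/-!
# [AbsTopIII] Cor. 1.10 (i)(a), levels: the residue maps `inv_n : H²(G_K, μ_n) ⥲ ℤ/n` are compatible
# with the power maps `μ_N ↠ μ_n` (the INVERSE system behind `H²(G_K, Ẑ(1)) = lim_n H²(G_K, μ_n)`)

Mochizuki, *Topics in Absolute Anabelian Geometry III*, Cor. 1.10 (i)(a) p. 42: "the natural isomorphism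
`H²(G_k, μ_Ẑ(G_k)) ⥲ Ẑ`" — at finite levels this is the residue map `inv_n : H²(G_K, μ_n(K̄)) ⥲ ℤ/n` of
local class field theory, typed in the tree as THE invariant map `Prop121vii.invLevel K n`
(`LocalResidueMapQmodZ.lean`: the unique `IsInvariantMap`, [AbsAnab] Prop. 1.2.1 (vii); compatible
along the INCLUSIONS `μ_n ⊆ μ_N`, `Prop121vii.invariantMap_muInclHom_compat`, abc-iut-w5-d214).
Passing to `μ_Ẑ = lim_n μ_n` needs the compatibility along the PROJECTIONS `μ_N ↠ μ_n`
(`ζ ↦ ζ^{N/n}`, `muPowHom` of `GaloisCyclotomeTowerLevels.lean`):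

* `cohomologyMap_muInclHom_muPowHom` — `H²(μ_n ⊆ μ_N) ∘ H²(μ_N ↠ μ_n) = (N/n) ·` on `H²(G_k, μ_N)`
  (any field `k` of characteristic `0`; cocycle level: `ι ∘ π = [N/n]`);
* `invLevel_muPowHom` — **`inv_n (H²(μ_N ↠ μ_n) c) = (inv_N c mod n)`** for a `p`-adic local field
  `K` (`ℤ/N ↠ ℤ/n`): from the inclusion compatibility, the previous item and
  `(N/n)·a ≡ (N/n)·b (mod N) ⇒ a ≡ b (mod n)`;
* `invLevel_bijective` — each `inv_n` is a bijection (part of `IsInvariantMap`).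

HONEST FRAMING: classical local class field theory as proved in the tree (Serre, *Local Fields*
XIII §3: `inv` commutes with change of coefficients); nothing here bears on [IUTchIII] Cor. 3.12.

## References
* [MochizukiAbsTopIII2015] S. Mochizuki, *Topics in Absolute Anabelian Geometry III*, Cor. 1.10 (i) p. 42.
* [SerreLocalFields1979] J.-P. Serre, *Local Fields*, GTM 67, XIII §3, XIV §1.
-/

noncomputable section

open CategoryTheory Function

universe u

namespace Literature.AnabelianGeometry.AbsoluteAnabelian

open Field
open Literature.NumberTheory.GaloisRepresentations
open Literature.NumberTheory.GaloisRepresentations.DiscreteGaloisModule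

/-! ### `H²(μ_n ⊆ μ_N) ∘ H²(μ_N ↠ μ_n)` is multiplication by `N/n` -/

section Functoriality

variable (k : Type u) [Field k]

/-- On cocycles: pushing forward along `μ_N ↠ μ_n` (`ζ ↦ ζ^d`, `n d = N`) and then along `μ_n ⊆ μ_N`
multiplies a continuous `2`-cocycle of `μ_N(k̄)` by `d`.
[cite: MochizukiAbsTopIII2015, Cor 1.10 (i) p.42] -/
theorem push_muInclHom_push_muPowHom {n d N : ℕ} (h : n * d = N)
    (z : contTwoCocycles (mu k N).toTopRep) :
    contTwoCocycles.push (muInclHom k (Dvd.intro d h))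
        (contTwoCocycles.push (muPowHom k N n d h) z) = d • z := by
  refine Subtype.ext (ContinuousMap.ext fun p => ?_)
  obtain ⟨σ, τ⟩ := p
  rw [contTwoCocycles.push_apply, contTwoCocycles.push_apply, Submodule.coe_smul_of_tower,
    ContinuousMap.smul_apply]
  apply muVal_injective k N
  rw [muInclHom_hom_apply, muVal_muInclusion, muPowHom_hom_apply, muVal_muPow, muVal_nsmul]

variable [CharZero k]

/-- **`H²(μ_n ⊆ μ_N) ∘ H²(μ_N ↠ μ_n) = (N/n) ·`** on `H²(G_k, μ_N(k̄))` (`n d = N`; `ι ∘ π = [d]`).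
[cite: MochizukiAbsTopIII2015, Cor 1.10 (i) p.42] -/
theorem cohomologyMap_muInclHom_muPowHom {n d N : ℕ} (h : n * d = N)
    (c : continuousCohomology 2 (mu k N).toTopRep) :
    (cohomologyMap (muInclHom k (Dvd.intro d h)) 2).hom
        ((cohomologyMap (muPowHom k N n d h) 2).hom c) = d • c := by
  obtain ⟨z, rfl⟩ := twoCocycleClass_surjective _ c
  rw [cohomologyMap_hom_twoCocycleClass, cohomologyMap_hom_twoCocycleClass,
    push_muInclHom_push_muPowHom, ← twoCocycleClassₗ_apply, map_nsmul, twoCocycleClassₗ_apply]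

end Functoriality

/-! ### The residue maps are compatible with the power maps -/

section Residue

variable (K : Type u) [Field K] [ValuativeRel K] [TopologicalSpace K] [IsNonarchimedeanLocalField K]
  [CharZero K]

/-- An auxiliary congruence: `d·b ≡ a·d (mod N)`, `N = n·d`, `d ≠ 0`, forces `a ≡ b (mod n)` in `ℤ/n`.
[cite: SerreLocalFields1979, XIII §3] -/
theorem zmod_natCast_eq_of_mul_eq {n d N : ℕ} (h : n * d = N) (hd : d ≠ 0) {a b : ℕ}
    (H : ((d * b : ℕ) : ZMod N) = ((a * d : ℕ) : ZMod N)) :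
    (a : ZMod n) = (b : ZMod n) := by
  subst h
  rw [ZMod.natCast_eq_natCast_iff, mul_comm d b] at H
  exact (ZMod.natCast_eq_natCast_iff _ _ _).2 (Nat.ModEq.mul_right_cancel' hd H).symm

/-- **The residue maps commute with the power maps**: for `n d = N` and `c ∈ H²(G_K, μ_N(K̄))`,
`inv_n (H²(μ_N ↠ μ_n) c) = inv_N c mod n` — the level-`n` residue of the `d`-th-power push-forward is
the reduction `ℤ/N ↠ ℤ/n` of the level-`N` residue (so the `inv_n` assemble on the INVERSE system
`H²(G_K, μ_Ẑ) = lim_n H²(G_K, μ_n) → lim_n ℤ/n = Ẑ` of [AbsTopIII] Cor. 1.10 (i)(a)).  From the inclusion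
compatibility `inv_N ∘ H²(μ_n ⊆ μ_N) = (N/n)·inv_n` (abc-iut-w5-d214) and `H²(⊆) ∘ H²(↠) = (N/n)·`.
[cite: MochizukiAbsTopIII2015, Cor 1.10 (i) p.42] -/
theorem invLevel_muPowHom_hom {n d N : ℕ} [NeZero n] [NeZero N] (h : n * d = N)
    (c : continuousCohomology 2 (mu K N).toTopRep) :
    Prop121vii.invLevel K n ((cohomologyMap (muPowHom K N n d h) 2).hom c) =
      ZMod.castHom (Dvd.intro d h) (ZMod n) (Prop121vii.invLevel K N c) := by
  have hd : d ≠ 0 := fun hd => NeZero.ne N (by rw [← h, hd, mul_zero])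
  have hNn : N / n = d := by rw [← h, Nat.mul_div_cancel_left d (NeZero.pos n)]
  -- the residue maps read on the carriers of continuous cohomology
  let ιn : continuousCohomology 2 (mu K n).toTopRep →+ ZMod n := Prop121vii.invLevel K n
  let ιN : continuousCohomology 2 (mu K N).toTopRep →+ ZMod N := Prop121vii.invLevel K N
  -- the inclusion compatibility at `x := H²(↠) c`
  have H := Prop121vii.invariantMap_muInclHom_compat K (Dvd.intro d h) (Prop121vii.invLevel K n)
    (Prop121vii.invLevel K N) (Prop121vii.isInvariantMap_invLevel K n)
    (Prop121vii.isInvariantMap_invLevel K N) ((cohomologyMap (muPowHom K N n d h) 2).hom c)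
  change ιN ((cohomologyMap (muInclHom K (Dvd.intro d h)) 2).hom
      ((cohomologyMap (muPowHom K N n d h) 2).hom c)) =
    (((ιn ((cohomologyMap (muPowHom K N n d h) 2).hom c)).val * (N / n) : ℕ) : ZMod N) at H
  rw [cohomologyMap_muInclHom_muPowHom, map_nsmul, hNn] at H
  change ιn ((cohomologyMap (muPowHom K N n d h) 2).hom c) = ZMod.castHom _ (ZMod n) (ιN c)
  -- `H : d • ιN c = ↑((ιn _).val * d)` in `ℤ/N`
  have H' : ((d * (ιN c).val : ℕ) : ZMod N) =
      (((ιn ((cohomologyMap (muPowHom K N n d h) 2).hom c)).val * d : ℕ) : ZMod N) := by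
    rw [← H, Nat.cast_mul, ZMod.natCast_zmod_val, nsmul_eq_mul]
  rw [ZMod.castHom_apply, ZMod.cast_eq_val, ← zmod_natCast_eq_of_mul_eq h hd H',
    ZMod.natCast_zmod_val]

/-- The same on the synonym `galoisCohomology (mu K N) 2` with the coercion-applied form of the
transition. [cite: MochizukiAbsTopIII2015, Cor 1.10 (i) p.42] -/
theorem invLevel_muPowHom {n d N : ℕ} [NeZero n] [NeZero N] (h : n * d = N)
    (c : galoisCohomology (mu K N) 2) :
    Prop121vii.invLevel K n (cohomologyMap (muPowHom K N n d h) 2 c) =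
      ZMod.castHom (Dvd.intro d h) (ZMod n) (Prop121vii.invLevel K N c) :=
  invLevel_muPowHom_hom K h c

/-- `invLevel K n` is a bijection (part of `IsInvariantMap`). [cite: MochizukiAbsTopIII2015, Cor 1.10 (i) p.42] -/
theorem invLevel_bijective (n : ℕ) [NeZero n] : Bijective (Prop121vii.invLevel K n) := by
  haveI : CompactSpace (absoluteGaloisGroup K) := absoluteGaloisGroup_compactSpace K
  exact (Prop121vii.isInvariantMap_invLevel K n).1

end Residue


end Literature.AnabelianGeometry.AbsoluteAnabelian

end
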